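import Literature.NumberTheory.LFunctions.HeckeThetaComplexWeightMellin
import Literature.NumberTheory.LFunctions.GrossencharakterFinitePartGaussSum
import Literature.NumberTheory.LFunctions.RayClassFunctionalEquation
import Literature.NumberTheory.LFunctions.RayClassCharacterGrowth
import Literature.NumberTheory.GaloisRepresentations.HeckeCharacterValueFieldProofs
import HarnessLib

/-!
# The `L`-series of a Größencharakter of type `(m, 0)` of an imaginary quadratic field: weight, convergence, and the
# f-side of Hecke's functional equation (Neukirch VII (8.1)–(8.3))

Topic `Literature/NumberTheory/LFunctions`; namespace `Literature.NumberTheory.LFunctions`.  Fifth file of the proof of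
Hecke's functional equation for Größencharaktere of infinity type `(m, 0)` of an imaginary quadratic field (Hecke 1920; de
Shalit 1987 II.1.1 (1)–(3); Neukirch VII (8.5)–(8.6)), after `HeckeGaussianFourierComplex`, `HeckeThetaInversionComplexWeight`,
`HeckeThetaComplexWeightMellin` (analysis) and `GrossencharakterFinitePartGaussSum` (algebra).  Everything is PROVED; no
named fact, no definition.

Setting: `K` a number field with a complex place `w` and `[K:ℚ] = 2` (imaginary quadratic), `σ = σ_w` its embedding, a
modulus `𝔪 ≠ 0`, and `ψ` with `HasEmbPowType 𝔪 σ_w m ψ` (`χ̃ = idealPow K ψ` has type `σ^m` on the ray mod `𝔪`; de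
Shalit's type `(m, 0)`).  The `L`-series is the tree's `rayClassLSeries 𝔪 ψ s = Σ_𝔞 χ'(𝔞) 𝔑𝔞^{-s}` (`χ' = χ̃` on the
ideals prime to `𝔪`, `0` elsewhere).

* §1 **Weight** (Weil; de Shalit II.1.1 "`χ χ̄ = N^k`"): `‖χ̃(𝔞)‖² = 𝔑𝔞^m` for `𝔞` prime to `𝔪`
  (`sq_norm_idealPow_eq_absNorm_pow`; some power `𝔞^k` lies on the ray, `HeckeCharacter.exists_pos_rayClassRel_top_pow`),
  hence `‖ψ(𝔭)‖ = 𝔑𝔭^{m/2}` and **absolute convergence of `L(χ, s)` for `re s > m/2 + 1`**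
  (`summable_norm_rayClassCoeff_mul_of_embPowType`, via the tree's growth lemma `summable_norm_rayClassCoeff_mul_of_growth`),
  and the decomposition by ideal classes `rayClassLSeries_eq_sum_classes_of_embPowType`.
* §2 **The f-side per ideal class** (Neukirch VII (8.3) in the coset language of Remark 1, with the harmonic weight): for
  `𝔟 ≠ 0` integral prime to `𝔪`, `b₀ ∈ 𝔟`, `b₀ ≡ 1 mod 𝔪`, and the strong FE-pairs `P_q` (`heckeThetaPairC`) of the cosets
  `r_q b₀ + 𝔪𝔟` (`r_q` nonzero representatives of `𝒪/𝔪`),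
  `Σ_q χ_f(r_q) Λ_{P_q}(s) = (2π)^{-s} Γ(s) h₀ χ̃(𝔟) 𝔑𝔟^{-s} Σ_{𝔞 ∈ [𝔟]⁻¹} χ'(𝔞) 𝔑𝔞^{-s}`  (`re s > m/2 + 1`;
  `h₀ = orbitMult K N = #μ(K)` here) — `sum_grossFinitePart_mul_Λ_eq`.

The g-side, the root number and the functional equation itself are in the sequel
`ImaginaryQuadraticGrossencharakterFunctionalEquation.lean`.

## References

* J. Neukirch, *Algebraic Number Theory*, Grundlehren 322, Springer 1999, Ch. VII §6 (6.13), §8 (8.1)–(8.3) and Remark 1.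
  [NeukirchANT1999]
* E. de Shalit, *Iwasawa theory of elliptic curves with complex multiplication*, Academic Press 1987, II §1.1. [deShalit1987]
* E. Hecke, Math. Z. 6 (1920), 11–51. [HeckeMathZ1920]
-/

noncomputable section

open scoped FourierTransform nonZeroDivisors ComplexConjugate Real
open NumberField NumberField.InfinitePlace IsDedekindDomain Complex
open Literature.NumberTheory.GaloisRepresentations

namespace Literature.NumberTheory.LFunctions

variable {K : Type*} [Field K] [NumberField K]

open scoped Classical

/-! ## §1. The weight: `‖χ̃(𝔞)‖² = 𝔑𝔞^m`, convergence, classes -/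

section Weight

variable (w : {w : InfinitePlace K // IsComplex w}) (h2 : Module.finrank ℚ K = 2)
  {𝔪 : Ideal (𝓞 K)} {ψ : HeightOneSpectrum (𝓞 K) → ℂ} {m : ℕ}

include h2 in
/-- `‖σ_w b‖² = 𝔑((b))` for an integer `b` of an imaginary quadratic field. [cite: NeukirchANT1999, Ch. III §1 (1.3), product formula] -/
private theorem norm_embedding_sq_eq_absNorm_span (b : 𝓞 K) :
    ‖w.1.embedding (b : K)‖ ^ 2 = ((Ideal.absNorm (Ideal.span {b}) : ℕ) : ℝ) := by
  rw [NumberField.norm_embedding_sq_eq_abs_norm w h2 (b : K), Ideal.absNorm_span_singleton, Nat.cast_natAbs,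
    ← Algebra.coe_norm_int, Int.cast_abs]
  push_cast
  rfl

include h2 in
/-- ★ **`‖χ̃(𝔞)‖² = 𝔑𝔞^m` for a Größencharakter of type `(m, 0)` of an imaginary quadratic field** and `𝔞 ≠ 0` prime to `𝔪`
(Weil: a character of type `(A₀)` and weight `m` has `|χ(𝔞)| = N𝔞^{m/2}`; de Shalit II.1.1).  Proof: some `𝔞^k` is `(b/c)`
on the ray (`exists_pos_rayClassRel_top_pow`), so `χ̃(𝔞)^k σ(c)^m = σ(b)^m` and `|σ b|²/|σ c|² = 𝔑((b))/𝔑((c)) = 𝔑𝔞^k`.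
[cite: deShalit1987, II.1.1 (p. 32–33)] [cite: NeukirchANT1999, Ch. VII §6 Prop. (6.13)] -/
theorem sq_norm_idealPow_eq_absNorm_pow (hψ : HasEmbPowType 𝔪 w.1.embedding m ψ) (h𝔪 : 𝔪 ≠ ⊥)
    {𝔞 : Ideal (𝓞 K)} (h𝔞 : 𝔞 ≠ ⊥) (hcop : IsCoprime 𝔞 𝔪) :
    ‖idealPow K ψ 𝔞‖ ^ 2 = (((Ideal.absNorm 𝔞 : ℕ) : ℝ)) ^ m := by
  obtain ⟨k, hk, b, c, hb, hc, hccop, hbc, -, heq⟩ := HeckeCharacter.exists_pos_rayClassRel_top_pow h𝔪 h𝔞 hcop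
  rw [Ideal.mul_top] at heq
  -- `χ̃((c)) χ̃(𝔞)^k = χ̃((b))` and the ray relation `χ̃((b)) σ(c)^m = χ̃((c)) σ(b)^m`
  have hc' : Ideal.span {c} ≠ ⊥ := by simpa using hc
  have hval : idealPow K ψ (Ideal.span {c}) * idealPow K ψ 𝔞 ^ k = idealPow K ψ (Ideal.span {b}) := by
    rw [← idealPow_pow ψ h𝔞, ← idealPow_mul ψ hc' (pow_ne_zero k h𝔞), heq]
  have hrel := hψ.rel b c hb hc hccop hbc
  have hIc : idealPow K ψ (Ideal.span {c}) ≠ 0 := hψ.idealPow_ne_zero hc' hccop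
  have hkey : idealPow K ψ 𝔞 ^ k * w.1.embedding (c : K) ^ m = w.1.embedding (b : K) ^ m := by
    apply mul_left_cancel₀ hIc
    rw [← mul_assoc, hval, hrel]
  -- norms of ideals: `𝔑((c)) 𝔑𝔞^k = 𝔑((b))`
  have hN : (Ideal.absNorm (Ideal.span {c}) : ℕ) * Ideal.absNorm 𝔞 ^ k = Ideal.absNorm (Ideal.span {b}) := by
    have := congrArg Ideal.absNorm heq
    simpa [map_mul, map_pow] using this
  have hNR : ((Ideal.absNorm (Ideal.span {c}) : ℕ) : ℝ) * ((Ideal.absNorm 𝔞 : ℕ) : ℝ) ^ k =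
      ((Ideal.absNorm (Ideal.span {b}) : ℕ) : ℝ) := by exact_mod_cast hN
  -- norms of the values
  have hv : (‖idealPow K ψ 𝔞‖ ^ 2) ^ k * (‖w.1.embedding (c : K)‖ ^ 2) ^ m = (‖w.1.embedding (b : K)‖ ^ 2) ^ m := by
    have h' := congrArg (fun z : ℂ ↦ ‖z‖ ^ 2) hkey
    simp only [norm_mul, norm_pow] at h'
    calc (‖idealPow K ψ 𝔞‖ ^ 2) ^ k * (‖w.1.embedding (c : K)‖ ^ 2) ^ m
        = (‖idealPow K ψ 𝔞‖ ^ k * ‖w.1.embedding (c : K)‖ ^ m) ^ 2 := by ring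
      _ = (‖w.1.embedding (b : K)‖ ^ m) ^ 2 := h'
      _ = (‖w.1.embedding (b : K)‖ ^ 2) ^ m := by ring
  rw [norm_embedding_sq_eq_absNorm_span w h2 c, norm_embedding_sq_eq_absNorm_span w h2 b, ← hNR] at hv
  have hc0 : (((Ideal.absNorm (Ideal.span {c}) : ℕ) : ℝ)) ^ m ≠ 0 := by
    have : Ideal.absNorm (Ideal.span {c}) ≠ 0 := by
      rw [Ne, Ideal.absNorm_eq_zero_iff, Ideal.span_singleton_eq_bot]; exact hc
    exact pow_ne_zero _ (by exact_mod_cast this)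
  have hpow : (‖idealPow K ψ 𝔞‖ ^ 2) ^ k = ((((Ideal.absNorm 𝔞 : ℕ) : ℝ)) ^ m) ^ k := by
    apply mul_right_cancel₀ hc0
    rw [hv]; ring
  exact (pow_left_inj₀ (sq_nonneg _) (by positivity) hk.ne').mp hpow

include h2 in
/-- **`‖χ̃(𝔞)‖ = 𝔑𝔞^{m/2}`** (real power) for `𝔞 ≠ 0` prime to `𝔪`. [cite: deShalit1987, II.1.1 (p. 32–33)] -/
theorem norm_idealPow_eq_absNorm_rpow (hψ : HasEmbPowType 𝔪 w.1.embedding m ψ) (h𝔪 : 𝔪 ≠ ⊥)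
    {𝔞 : Ideal (𝓞 K)} (h𝔞 : 𝔞 ≠ ⊥) (hcop : IsCoprime 𝔞 𝔪) :
    ‖idealPow K ψ 𝔞‖ = (((Ideal.absNorm 𝔞 : ℕ) : ℝ)) ^ ((m : ℝ) / 2) := by
  have h := sq_norm_idealPow_eq_absNorm_pow w h2 hψ h𝔪 h𝔞 hcop
  have hN : (0 : ℝ) ≤ ((Ideal.absNorm 𝔞 : ℕ) : ℝ) := Nat.cast_nonneg _
  have h1 : ‖idealPow K ψ 𝔞‖ = Real.sqrt ((((Ideal.absNorm 𝔞 : ℕ) : ℝ)) ^ m) := by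
    rw [← h, Real.sqrt_sq (norm_nonneg _)]
  rw [h1, Real.sqrt_eq_rpow, ← Real.rpow_natCast, ← Real.rpow_mul hN]
  congr 1
  ring

include h2 in
/-- **The growth bound at the primes**: `‖ψ(𝔭)‖ ≤ ‖𝔑𝔭^{m/2}‖` for `𝔭 ∤ 𝔪` (the hypothesis of the tree's
`summable_norm_rayClassCoeff_mul_of_growth`). [cite: NeukirchANT1999, Ch. VII §8 (8.1) Proposition] -/
theorem norm_apply_le_growth (hψ : HasEmbPowType 𝔪 w.1.embedding m ψ) (h𝔪 : 𝔪 ≠ ⊥) (v : HeightOneSpectrum (𝓞 K))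
    (hv : ¬ 𝔪 ≤ v.asIdeal) : ‖ψ v‖ ≤ ‖((Ideal.absNorm v.asIdeal : ℕ) : ℂ) ^ (((m : ℝ) / 2 : ℝ) : ℂ)‖ := by
  have hcop : IsCoprime v.asIdeal 𝔪 := by
    rw [isCoprime_iff_forall_not_le h𝔪]
    intro v' hv' hle
    have : v = v' := HeightOneSpectrum.ext (v.isMaximal.eq_of_le v'.isPrime.ne_top hle)
    exact hv (this ▸ hv')
  have hNpos : 0 < ((Ideal.absNorm v.asIdeal : ℕ) : ℝ) := by
    exact_mod_cast Nat.pos_of_ne_zero (by rw [Ne, Ideal.absNorm_eq_zero_iff]; exact v.ne_bot)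
  rw [← idealPow_asIdeal ψ v, norm_idealPow_eq_absNorm_rpow w h2 hψ h𝔪 v.ne_bot hcop,
    show ((Ideal.absNorm v.asIdeal : ℕ) : ℂ) = (((Ideal.absNorm v.asIdeal : ℕ) : ℝ) : ℂ) by push_cast; rfl,
    Complex.norm_cpow_eq_rpow_re_of_pos hNpos, Complex.ofReal_re]

include h2 in
/-- **Absolute convergence of `L(χ, s) = Σ_𝔞 χ'(𝔞) 𝔑𝔞^{-s}` for `re s > m/2 + 1`** (Neukirch VII (8.1), after the unitary
normalisation `χ 𝔑^{-m/2}`). [cite: NeukirchANT1999, Ch. VII §8 (8.1) Proposition] -/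
theorem summable_norm_rayClassCoeff_mul_of_embPowType (hψ : HasEmbPowType 𝔪 w.1.embedding m ψ) (h𝔪 : 𝔪 ≠ ⊥)
    (hm : 1 ≤ m) {s : ℂ} (hs : (m : ℝ) / 2 + 1 < s.re) :
    Summable fun I : Ideal (𝓞 K) ↦ ‖rayClassCoeff 𝔪 ψ I * ((Ideal.absNorm I : ℕ) : ℂ) ^ (-s)‖ := by
  refine summable_norm_rayClassCoeff_mul_of_growth h𝔪 (t := (((m : ℝ) / 2 : ℝ) : ℂ)) ?_
    (norm_apply_le_growth w h2 hψ h𝔪) ?_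
  · have h1 : (1 : ℝ) ≤ m := by exact_mod_cast hm
    have h0 : (m : ℝ) / 2 ≠ 0 := by positivity
    exact Complex.ofReal_ne_zero.mpr h0
  · simp only [Complex.sub_re, Complex.ofReal_re]; linarith

include h2 in
/-- **`L(χ, s) = Σ_D Σ_{𝔞 ∈ [𝔟_D]⁻¹} χ'(𝔞) 𝔑𝔞^{-s}`** for any family of nonzero integral ideals `𝔟_D` whose classes run
bijectively over the class group (Neukirch VII §8: `L(χ,s) = Σ_𝔎 L(𝔎,χ,s)`), for `re s > m/2 + 1`.
[cite: NeukirchANT1999, Ch. VII §8, before (8.2)] -/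
theorem rayClassLSeries_eq_sum_classes_of_embPowType (hψ : HasEmbPowType 𝔪 w.1.embedding m ψ) (h𝔪 : 𝔪 ≠ ⊥)
    (hm : 1 ≤ m) (𝔟 : ClassGroup (𝓞 K) → Ideal (𝓞 K)) (h𝔟 : ∀ D, 𝔟 D ≠ ⊥)
    (hbij : Function.Bijective fun D ↦ ClassGroup.mk0 ⟨𝔟 D, mem_nonZeroDivisors_iff_ne_zero.mpr (h𝔟 D)⟩)
    {s : ℂ} (hs : (m : ℝ) / 2 + 1 < s.re) :
    rayClassLSeries 𝔪 ψ s = ∑ D, ∑' 𝔞 : classImage ((𝔟 D : Ideal (𝓞 K)) : FractionalIdeal (𝓞 K)⁰ K),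
      rayClassCoeff 𝔪 ψ 𝔞 * ((Ideal.absNorm (𝔞 : Ideal (𝓞 K)) : ℕ) : ℂ) ^ (-s) := by
  set f : Ideal (𝓞 K) → ℂ := fun I ↦ rayClassCoeff 𝔪 ψ I * ((Ideal.absNorm I : ℕ) : ℂ) ^ (-s) with hf
  have hsum : Summable f := (summable_norm_rayClassCoeff_mul_of_embPowType w h2 hψ h𝔪 hm hs).of_norm
  have hsupp : Function.support f ⊆ {I : Ideal (𝓞 K) | I ≠ ⊥} := by
    intro I hI
    simp only [Function.mem_support, hf] at hI
    intro h0
    apply hI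
    rw [h0, rayClassCoeff_bot, zero_mul]
  rw [rayClassLSeries, show (∑' I : Ideal (𝓞 K), rayClassCoeff 𝔪 ψ I * ((Ideal.absNorm I : ℕ) : ℂ) ^ (-s)) = ∑' I, f I from rfl,
    ← tsum_subtype_eq_of_support_subset hsupp]
  exact tsum_ne_bot_eq_sum_tsum_classImage 𝔟 h𝔟 hbij f (hsum.comp_injective Subtype.val_injective)

end Weight

/-! ## §2. The f-side: the character combination of the coset Mellin transforms is a partial `L`-series -/

section FSide

variable (w : {w : InfinitePlace K // IsComplex w}) (h2 : Module.finrank ℚ K = 2)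
  {𝔪 : Ideal (𝓞 K)} {ψ : HeightOneSpectrum (𝓞 K) → ℂ} {m : ℕ}

include h2 in
/-- `‖σ_w x‖^m = |N_{K/ℚ}(x)|^{m/2}` (real power). [cite: NeukirchANT1999, Ch. III §1 (1.3), product formula] -/
theorem norm_embedding_pow_eq_abs_norm_rpow (x : K) :
    ‖w.1.embedding x‖ ^ m = (|(Algebra.norm ℚ x : ℚ)| : ℝ) ^ ((m : ℝ) / 2) := by
  rw [← NumberField.norm_embedding_sq_eq_abs_norm w h2, ← Real.rpow_natCast _ 2, ← Real.rpow_mul (norm_nonneg _),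
    ← Real.rpow_natCast]
  congr 1
  push_cast
  ring

include h2 in
/-- **The f-side of the functional equation, per ideal class** (Neukirch VII (8.3) with (5.4), in the coset language of
Remark 1, for the harmonic weight `σ^m` over an imaginary quadratic field).  Let `𝔟 ≠ 0` be an integral ideal prime to `𝔪`,
`b₀ ∈ 𝔟`, `b₀ ≡ 1 mod 𝔪`, `N ≠ 0`.  For the strong FE-pairs `P_q` (`heckeThetaPairC`) of the cosets `r_q b₀ + 𝔪𝔟` (`r_q` nonzero
representatives of `𝒪/𝔪`) one has, for `re s > m/2 + 1`,
`Σ_q χ_f(r_q) Λ_{P_q}(s) = (2π)^{-s} Γ(s) h₀ χ̃(𝔟) 𝔑(𝔟)^{-s} Σ_{𝔞 ∈ [𝔟]⁻¹} χ'(𝔞) 𝔑(𝔞)^{-s}` (`h₀ = orbitMult K N`): the cosets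
`r b₀ + 𝔪𝔟` partition `𝔟`, on such a coset `χ_f ≡ χ_f(r)`, and `χ_f(x) σ(x)^m = χ̃((x)) = χ̃(x𝔟⁻¹) χ̃(𝔟)`.
[cite: NeukirchANT1999, Ch. VII §8 (8.3) Proposition] -/
theorem sum_grossFinitePart_mul_Λ_eq (hψ : HasEmbPowType 𝔪 w.1.embedding m ψ) (hm : 1 ≤ m) (h𝔪 : 𝔪 ≠ ⊥)
    {𝔟 : Ideal (𝓞 K)} (h𝔟 : 𝔟 ≠ ⊥) (hcop : IsCoprime 𝔟 𝔪) {b₀ : 𝓞 K} (hb₀ : b₀ ∈ 𝔟) (hb₀1 : b₀ - 1 ∈ 𝔪)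
    {N : ℕ} (hN0 : N ≠ 0) [Fintype (𝓞 K ⧸ 𝔪)] {s : ℂ} (hs : (m : ℝ) / 2 + 1 < s.re) :
    ∑ q : 𝓞 K ⧸ 𝔪, grossFinitePart K 𝔪 ψ w.1.embedding m (liftNZ K 𝔪 q) *
        (NumberField.heckeThetaPairC K w h2 hm (Units.mk0 _ (coeIdeal_mul_ne_zero h𝔪 h𝔟)) ((liftNZ K 𝔪 q : K) * b₀)).Λ s =
      (2 * Real.pi : ℂ) ^ (-s) * Complex.Gamma s * (orbitMult K N : ℂ) *
        idealPow K ψ 𝔟 * ((Ideal.absNorm 𝔟 : ℕ) : ℂ) ^ (-s) *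
        ∑' 𝔞 : classImage ((𝔟 : Ideal (𝓞 K)) : FractionalIdeal (𝓞 K)⁰ K),
          rayClassCoeff 𝔪 ψ 𝔞 * ((Ideal.absNorm (𝔞 : Ideal (𝓞 K)) : ℕ) : ℂ) ^ (-s) := by
  classical
  set σ := w.1.embedding with hσ
  set B : FractionalIdeal (𝓞 K)⁰ K := (𝔟 : FractionalIdeal (𝓞 K)⁰ K) with hB
  have hB0 : B ≠ 0 := FractionalIdeal.coeIdeal_ne_zero.mpr h𝔟
  set r : 𝓞 K ⧸ 𝔪 → 𝓞 K := liftNZ K 𝔪 with hr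
  have hσ' : 1 < s.re - (m : ℝ) / 2 := by linarith
  -- Step 1: unfold each `Λ_{P_q}(s)`
  set hfun : K → ℂ := fun x ↦ σ x ^ m * (((|(Algebra.norm ℚ x : ℚ)| : ℝ) : ℂ) ^ (-s)) with hhfun
  have hΛ : ∀ q, (NumberField.heckeThetaPairC K w h2 hm (Units.mk0 _ (coeIdeal_mul_ne_zero h𝔪 h𝔟)) ((r q : K) * b₀)).Λ s =
      (2 * Real.pi : ℂ) ^ (-s) * Complex.Gamma s *
        ∑' x : NumberField.pieceReps K ∅ 1 (((𝔪 * 𝔟 : Ideal (𝓞 K)) : FractionalIdeal (𝓞 K)⁰ K)) ((r q : K) * b₀) N,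
          hfun x := by
    intro q
    rw [NumberField.heckeThetaPairC_Λ_eq h2 hm _ _ N hs, Units.val_mk0]
  simp_rw [hΛ]
  -- Step 2: collect the cosets into a sum over the box representatives of `𝔟`
  have hCB : (((𝔪 * 𝔟 : Ideal (𝓞 K)) : FractionalIdeal (𝓞 K)⁰ K)) ≤ B :=
    (FractionalIdeal.coeIdeal_le_coeIdeal K).mpr Ideal.mul_le_left
  have hint : ∀ x : boxReps B N, ∃ x' : 𝓞 K, x' ∈ 𝔟 ∧ (x' : K) = x := fun x ↦
    exists_coe_eq_of_mem_coeIdeal (mem_of_mem_boxReps x.2)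
  choose xi hxi𝔟 hxi using hint
  have hxi0 : ∀ x, xi x ≠ 0 := fun x h ↦ ne_zero_of_mem_boxReps x.2 (by rw [← hxi x, h]; rfl)
  set ρ : boxReps B N → 𝓞 K ⧸ 𝔪 := fun x ↦ Ideal.Quotient.mk 𝔪 (xi x) with hρ
  have hρ_spec : ∀ (x : boxReps B N) (q : 𝓞 K ⧸ 𝔪),
      (x : K) - (r q : K) * b₀ ∈ (((𝔪 * 𝔟 : Ideal (𝓞 K)) : FractionalIdeal (𝓞 K)⁰ K)) ↔ ρ x = q := by
    intro x q
    have hb₀q : Ideal.Quotient.mk 𝔪 (r q * b₀) = q := by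
      rw [map_mul, hr, mk_liftNZ h𝔪]
      have : Ideal.Quotient.mk 𝔪 b₀ = 1 := by rw [← (Ideal.Quotient.mk 𝔪).map_one, Ideal.Quotient.eq]; exact hb₀1
      rw [this, mul_one]
    rw [← hxi x, show (xi x : K) - (r q : K) * b₀ = ((xi x - r q * b₀ : 𝓞 K) : K) by push_cast; ring]
    constructor
    · intro h
      obtain ⟨z, hz, hzK⟩ := exists_coe_eq_of_mem_coeIdeal h
      have hz' : z = xi x - r q * b₀ := by exact_mod_cast hzK
      rw [hz'] at hz
      rw [hρ]; simp only
      rw [← hb₀q, Ideal.Quotient.eq]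
      exact Ideal.mul_le_right hz
    · intro h
      rw [hρ] at h; simp only at h
      rw [← hb₀q, Ideal.Quotient.eq] at h
      have hmem2 : xi x - r q * b₀ ∈ 𝔟 := 𝔟.sub_mem (hxi𝔟 x) (𝔟.mul_mem_left _ hb₀)
      have : xi x - r q * b₀ ∈ 𝔪 * 𝔟 := by
        rw [Ideal.mul_eq_inf_of_isCoprime hcop.symm]; exact ⟨h, hmem2⟩
      exact FractionalIdeal.mem_coeIdeal_of_mem _ this
  have hsum : Summable fun x : boxReps B N ↦ grossFinitePart K 𝔪 ψ σ m (r (ρ x)) * hfun x := by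
    refine Summable.of_norm_bounded (NumberField.summable_pieceReps_norm_rpow (K := K) ∅ 1 B 0 N hσ') fun x ↦ ?_
    have hx0 : (x : K) ≠ 0 := ne_zero_of_mem_boxReps x.2
    have hNpos : (0 : ℝ) < (|(Algebra.norm ℚ (x : K) : ℚ)| : ℝ) := by
      exact_mod_cast abs_pos.mpr ((Algebra.norm_ne_zero_iff).mpr hx0)
    rw [norm_mul, hhfun]
    simp only [norm_mul, norm_pow]
    have h1 := norm_grossFinitePart_le_one hψ h𝔪 (r (ρ x))
    have h3 : ‖((|(Algebra.norm ℚ (x : K) : ℚ)| : ℝ) : ℂ) ^ (-s)‖ = (|(Algebra.norm ℚ (x : K) : ℚ)| : ℝ) ^ (-s.re) := by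
      rw [Complex.norm_cpow_eq_rpow_re_of_pos hNpos]; simp
    rw [h3, norm_embedding_pow_eq_abs_norm_rpow w h2, show -(s.re - (m : ℝ) / 2) = (m : ℝ) / 2 + -s.re by ring,
      Real.rpow_add hNpos]
    calc ‖grossFinitePart K 𝔪 ψ σ m (r (ρ x))‖ *
          ((|(Algebra.norm ℚ (x : K) : ℚ)| : ℝ) ^ ((m : ℝ) / 2) * (|(Algebra.norm ℚ (x : K) : ℚ)| : ℝ) ^ (-s.re))
        ≤ 1 * ((|(Algebra.norm ℚ (x : K) : ℚ)| : ℝ) ^ ((m : ℝ) / 2) * (|(Algebra.norm ℚ (x : K) : ℚ)| : ℝ) ^ (-s.re)) := by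
          gcongr
      _ = _ := by ring
  have hcollect := sum_mul_tsum_pieceReps_eq_tsum_boxReps hCB N (fun q ↦ (r q : K) * b₀)
    (fun q ↦ FractionalIdeal.mem_coeIdeal_of_mem _ (𝔟.mul_mem_left _ hb₀)) ρ hρ_spec
    (fun q ↦ grossFinitePart K 𝔪 ψ σ m (r q)) hfun hsum
  have hLHS : ∑ q : 𝓞 K ⧸ 𝔪, grossFinitePart K 𝔪 ψ σ m (r q) *
      ((2 * Real.pi : ℂ) ^ (-s) * Complex.Gamma s *
        ∑' x : NumberField.pieceReps K ∅ 1 (((𝔪 * 𝔟 : Ideal (𝓞 K)) : FractionalIdeal (𝓞 K)⁰ K)) ((r q : K) * b₀) N,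
          hfun x) =
      (2 * Real.pi : ℂ) ^ (-s) * Complex.Gamma s *
        ∑' x : boxReps B N, grossFinitePart K 𝔪 ψ σ m (r (ρ x)) * hfun x := by
    rw [← hcollect, Finset.mul_sum]
    exact Finset.sum_congr rfl fun q _ ↦ by ring
  rw [hLHS]
  -- Step 3: the summand only depends on the ideal `x𝔟⁻¹`
  set G : classImage B → ℂ := fun 𝔞 ↦ rayClassCoeff 𝔪 ψ ((𝔞 : Ideal (𝓞 K)) * 𝔟) *
    ((((Ideal.absNorm (𝔞 : Ideal (𝓞 K)) : ℝ) * (Ideal.absNorm 𝔟 : ℝ) : ℝ) : ℂ) ^ (-s)) with hG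
  have hpt : ∀ x : boxReps B N, grossFinitePart K 𝔪 ψ σ m (r (ρ x)) * hfun x = G (boxIdealMap B N x) := by
    intro x
    have hxK : ((xi x : 𝓞 K) : K) ∈ B := by rw [hxi x]; exact mem_of_mem_boxReps x.2
    have h1 : grossFinitePart K 𝔪 ψ σ m (r (ρ x)) = grossFinitePart K 𝔪 ψ σ m (xi x) :=
      grossFinitePart_congr hψ (liftNZ_ne_zero h𝔪 _) (hxi0 x) (by rw [← Ideal.Quotient.eq, hr, mk_liftNZ h𝔪])
    have hspan : Ideal.span {xi x} = (boxIdealMap B N x : Ideal (𝓞 K)) * 𝔟 := by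
      rw [span_singleton_eq_eltIdeal_mul h𝔟 hxK]
      congr 1
      exact eltIdeal_congr hxK (mem_of_mem_boxReps x.2) (hxi x)
    have h3 : (|(Algebra.norm ℚ (x : K) : ℚ)| : ℝ) =
        (Ideal.absNorm (boxIdealMap B N x : Ideal (𝓞 K)) : ℝ) * (Ideal.absNorm 𝔟 : ℝ) := by
      have := abs_norm_eq_absNorm_eltIdeal_mul hB0 (mem_of_mem_boxReps x.2)
      change _ = _ * FractionalIdeal.absNorm ((𝔟 : Ideal (𝓞 K)) : FractionalIdeal (𝓞 K)⁰ K) at this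
      rw [FractionalIdeal.coeIdeal_absNorm] at this
      have h' : (|(Algebra.norm ℚ (x : K) : ℚ)| : ℝ) = ((Ideal.absNorm (eltIdeal B x (mem_of_mem_boxReps x.2)) : ℚ) : ℝ) *
          ((Ideal.absNorm 𝔟 : ℚ) : ℝ) := by exact_mod_cast this
      rw [h']; push_cast; rfl
    rw [hhfun]; simp only
    rw [h1, ← hxi x, ← mul_assoc, grossFinitePart_mul_pow_eq_rayClassCoeff (hxi0 x), hspan, hxi x, h3, hG]
  rw [tsum_congr hpt, tsum_boxReps_eq_orbitMult_mul_tsum hN0 hB0 G ((hsum.congr hpt)), hG]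
  simp only
  -- Step 4: `χ'(𝔞𝔟) (𝔑𝔞 𝔑𝔟)^{-s} = χ̃(𝔟) 𝔑𝔟^{-s} · χ'(𝔞) 𝔑𝔞^{-s}`
  have hterm : ∀ 𝔞 : classImage B, rayClassCoeff 𝔪 ψ ((𝔞 : Ideal (𝓞 K)) * 𝔟) *
      ((((Ideal.absNorm (𝔞 : Ideal (𝓞 K)) : ℝ) * (Ideal.absNorm 𝔟 : ℝ) : ℝ) : ℂ) ^ (-s)) =
      idealPow K ψ 𝔟 * ((Ideal.absNorm 𝔟 : ℕ) : ℂ) ^ (-s) *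
        (rayClassCoeff 𝔪 ψ 𝔞 * ((Ideal.absNorm (𝔞 : Ideal (𝓞 K)) : ℕ) : ℂ) ^ (-s)) := by
    intro 𝔞
    rw [rayClassCoeff_mul_of_isCoprime h𝔟 hcop, Complex.ofReal_mul,
      Complex.mul_cpow_ofReal_nonneg (Nat.cast_nonneg _) (Nat.cast_nonneg _)]
    push_cast
    ring
  rw [tsum_congr hterm, tsum_mul_left]
  ring

end FSide

end Literature.NumberTheory.LFunctions

end
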